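import Literature.NumberTheory.LFunctions.StarkNoQuadraticSubfieldProofs
import HarnessLib

/-!
# Aramata–Brauer at a point and Stark's theorem on the subfields of a Galois number field

Topic `Literature/NumberTheory/LFunctions`, namespaces `Literature.NumberTheory.LFunctions.Heilbronn`
(one abstract inequality) and `Literature.NumberTheory.LFunctions.NumberField` (the number-field forms).
Everything in this file is PROVED (theorems only: no definition, no named fact, no `sorry`).

Two classical consequences of Heilbronn's formalism (`HeilbronnCharacter.lean`, `HeilbronnBound.lean`,
`HeilbronnStark.lean`), stated for a GALOIS number field `N/ℚ` given as a type and its intermediate fields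
`E : IntermediateField ℚ N` (the form in which they are consumed by prime-counting arguments in the
subfields of `N`):

* `Heilbronn.artinOrder_indClassFun_one_le_leftRegular` — the ARAMATA–BRAUER INEQUALITY in Heilbronn's
  language: `n(G, Ind_H^G 1) ≤ n(G, r_G)` at every `s₀ ≠ 1`, i.e. `ord_{s₀} ζ_{F_H} ≤ ord_{s₀} ζ_N`
  ([MurtyMurty1997, Ch. 2 §5, proof of Prop. 5.2]: "`θ_G(g)` … is bounded by `n(G, reg)` in absolute
  value"; applied to `n(G, Ind_H^G 1) = ⟨1_H, θ_G|_H⟩_H`).  [Aramata 1933, Brauer 1947: `ζ_N/ζ_{F_H}` is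
  entire.]
* `dedekindZetaCont_eq_zero_of_intermediateField` — **Aramata–Brauer at a point**: for `N/ℚ` Galois,
  `E ⊆ N` and `s₀ ≠ 1`, `ζ_E(s₀) = 0 ⟹ ζ_N(s₀) = 0`.
* `exists_quadratic_forall_dedekindZetaCont_eq_zero_iff` — **Stark's theorem for the subfields of a
  Galois field** ([Stark1974, Thm. 3]; [MurtyMurty1997, Ch. 2 Prop. 5.2, Cor. 6.2]): if `N/ℚ` is
  Galois of degree `> 1` and `ζ_N(σ) = 0` for a real `σ` with `1 − 1/(4 log|d_N|) ≤ σ < 1` (so that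
  `ord_σ ζ_N ≤ 1`, Stark's Lemma 3), then there is a QUADRATIC subfield `k ⊆ N` such that for EVERY
  intermediate field `E ⊆ N`: `ζ_E(σ) = 0 ↔ k ⊆ E`.  Subgroup form
  `exists_index_two_forall_dedekindZetaCont_fixedField_eq_zero_iff`: there is `K₁ ≤ Gal(N/ℚ)` of
  index `2` with `ζ_{N^H}(σ) = 0 ↔ H ≤ K₁` for every subgroup `H`.

Proof: embed `N` in `ℚ̄` (`f = IsAlgClosed.lift`, `N₀ = f(N)` normal), `q : Γ_ℚ → Gal(N₀/ℚ)`
(`isArtinQuotient_of_eq_restrictNormalHom`); an intermediate field `E` of `N` is the fixed field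
`F_{H_E}`, `H_E = q(Γ_{f(E)})`, cut out by `q` (`quotientFixedField_map_fixingSubgroup`), and
`ζ_{F_{H_E}} = ζ_E` (iso-invariance).  Heilbronn's structure theorem `θ_G ∈ {0, χ₁}`
(`heilbronnChar_eq_zero_or_eq_coe`) and `ζ_{F_H}(σ) = 0 ↔ H ≤ ker χ₁`
(`dedekindZetaCont_quotientFixedField_eq_zero_iff`) give the quadratic field `k = f⁻¹(F_{ker χ₁})`;
the equivalence `H_E ≤ ker χ₁ ↔ F_{ker χ₁} ≤ f(E)` is the (infinite) Galois correspondence for the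
closed subgroup `q⁻¹(ker χ₁)`.

## References

* H. M. Stark, *Some effective cases of the Brauer–Siegel theorem*, Invent. Math. 23 (1974)
  135–152, Lemma 3, Theorem 3. [Stark1974]
* M. R. Murty, V. K. Murty, *Non-vanishing of `L`-functions and applications*, Birkhäuser 1997,
  Ch. 2 §5 Prop. 5.2, §6 Cor. 6.2. [MurtyMurty1997]
* H. Aramata, *Über die Teilbarkeit der Dedekindschen Zetafunktionen*, Proc. Imp. Acad. Tokyo 9
  (1933) 31–34; R. Brauer, *On the zeta-functions of algebraic number fields*, Amer. J. Math. 69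
  (1947) 243–250. [folklore]
-/

noncomputable section

open scoped NumberField ComplexConjugate ComplexOrder
open Complex NumberField IntermediateField
open Literature.NumberTheory.Automorphic Literature.NumberTheory.LFunctions.Heilbronn
open Literature.RepresentationTheory.FiniteGroups

attribute [local instance 1001] AlgebraicClosure.instAlgebra IntermediateField.algebra'
  IntermediateField.module'

namespace Literature.NumberTheory.LFunctions

/-! ### The Aramata–Brauer inequality in Heilbronn's language -/

namespace Heilbronn

variable {F : Type} [Field F] [NumberField F] {G : Type} [Group G] [Fintype G]
  {q : Field.absoluteGaloisGroup F →* G}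

/-- **Aramata–Brauer inequality**: `n(G, Ind_H^G 1) ≤ n(G, r_G)` at every `s₀ ≠ 1`, i.e.
`ord_{s₀} ζ_{F_H} ≤ ord_{s₀} ζ_N` (`n(G, Ind_H^G 1) = ⟨1_H, θ_G|_H⟩_H` is an average of values of
`θ_G`, each bounded by `θ_G(1) = n(G, r_G)` in absolute value).
[cite: MurtyMurty1997, Ch. 2 §5 Prop. 5.2 (proof)] -/
theorem artinOrder_indClassFun_one_le_leftRegular (hq : IsArtinQuotient q) {s₀ : ℂ} (hs₀ : s₀ ≠ 1)
    (H : Subgroup G) :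
    artinOrder s₀ (indClassFun H (fun _ => (1 : ℂ)) ∘ q) ≤
      artinOrder s₀ ((Representation.leftRegular ℂ G).character ∘ q) := by
  classical
  set nH : ℤ := artinOrder s₀ (indClassFun H (fun _ => (1 : ℂ)) ∘ q) with hnH
  set nR : ℤ := artinOrder s₀ ((Representation.leftRegular ℂ G).character ∘ q) with hnR
  have h1 : heilbronnChar q s₀ 1 = (nR : ℂ) := heilbronnChar_one hq s₀
  have hbound : ∀ g : G, ‖heilbronnChar q s₀ g‖ ≤ (nR : ℝ) := by
    intro g
    have h := norm_heilbronnChar_le hq hs₀ g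
    rwa [h1, Complex.intCast_re] at h
  have hcl : (nH : ℂ) = classInner (fun _ : H => (1 : ℂ)) (fun h : H => heilbronnChar q s₀ h) :=
    artinOrder_indClassFun_one_eq_classInner hq s₀ H
  -- `|⟨1_H, θ_G|_H⟩_H| ≤ (1/|H|) Σ_h |θ_G(h⁻¹)| ≤ n_R`
  have hcard : (0 : ℝ) < Fintype.card H := by exact_mod_cast Fintype.card_pos
  have hnorm : ‖(nH : ℂ)‖ ≤ nR := by
    rw [hcl, classInner_apply, norm_mul, norm_inv, Complex.norm_natCast]
    have hsum : ‖∑ s : H, (1 : ℂ) * heilbronnChar q s₀ ((s⁻¹ : H) : G)‖ ≤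
        ∑ _s : H, (nR : ℝ) := by
      refine (norm_sum_le _ _).trans (Finset.sum_le_sum fun s _ => ?_)
      rw [one_mul]
      exact hbound _
    rw [Finset.sum_const, Finset.card_univ, nsmul_eq_mul] at hsum
    calc (Fintype.card H : ℝ)⁻¹ * ‖∑ s : H, (1 : ℂ) * heilbronnChar q s₀ ((s⁻¹ : H) : G)‖
        ≤ (Fintype.card H : ℝ)⁻¹ * ((Fintype.card H : ℝ) * nR) :=
          mul_le_mul_of_nonneg_left hsum (by positivity)
      _ = nR := by field_simp
  have habs : ((nH : ℤ) : ℝ) ≤ ‖(nH : ℂ)‖ := by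
    rw [Complex.norm_intCast]
    exact le_abs_self _
  exact_mod_cast habs.trans hnorm

/-- **Aramata–Brauer at a point, abstract form**: for `s₀ ≠ 1`, if `ζ_{F_H}(s₀) = 0` then
`ζ_{F_1}(s₀) = 0` for the field `F_1 = F̄^{ker q}` of `G`. [cite: MurtyMurty1997, Ch. 2 §5 Prop. 5.2] -/
theorem dedekindZetaCont_quotientFixedField_bot_eq_zero (hq : IsArtinQuotient q) {s₀ : ℂ}
    (hs₀ : s₀ ≠ 1) (H : Subgroup G) [NumberField (quotientFixedField q H)]
    [NumberField (quotientFixedField q (⊥ : Subgroup G))]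
    (h0 : dedekindZetaCont (quotientFixedField q H) s₀ = 0) :
    dedekindZetaCont (quotientFixedField q (⊥ : Subgroup G)) s₀ = 0 := by
  classical
  have hH := ((artinOrder_indClassFun_one_pos_iff hq hs₀ H).2).mpr h0
  have hle := artinOrder_indClassFun_one_le_leftRegular hq hs₀ H
  rw [← indClassFun_bot_one] at hle
  exact ((artinOrder_indClassFun_one_pos_iff hq hs₀ ⊥).2).mp (lt_of_lt_of_le hH hle)

end Heilbronn

/-! ### The number-field forms, for a Galois `N/ℚ` given as a type -/

namespace NumberField

section Galois

variable (N : Type) [Field N] [NumberField N] [IsGalois ℚ N]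

/-- For an `F`-algebra map into `L` and intermediate fields `k ≤ f.fieldRange`, `E`:
`k ≤ E.map f ↔ k.comap f ≤ E`. [folklore] -/
private theorem le_map_iff_comap_le_of_le_fieldRange {F K L : Type*} [Field F] [Field K] [Field L]
    [Algebra F K] [Algebra F L] (f : K →ₐ[F] L) {k : IntermediateField F L} (hk : k ≤ f.fieldRange)
    (E : IntermediateField F K) : k ≤ E.map f ↔ k.comap f ≤ E := by
  constructor
  · intro h x hx
    obtain ⟨y, hy, hyx⟩ := h hx
    rwa [← f.injective hyx]
  · intro h y hy
    obtain ⟨x, rfl⟩ := hk hy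
    exact ⟨x, h hy, rfl⟩

/-- **Aramata–Brauer at a point**: for a Galois number field `N/ℚ`, an intermediate field `E ⊆ N`
and `s₀ ≠ 1`, `ζ_E(s₀) = 0 ⟹ ζ_N(s₀) = 0` (the zeros of `ζ_E` are zeros of `ζ_N`).
[cite: MurtyMurty1997, Ch. 2 §5 Prop. 5.2] -/
theorem dedekindZetaCont_eq_zero_of_intermediateField (E : IntermediateField ℚ N) {s₀ : ℂ}
    (hs₀ : s₀ ≠ 1) (h0 : dedekindZetaCont E s₀ = 0) : dedekindZetaCont N s₀ = 0 := by
  classical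
  let L := AlgebraicClosure ℚ
  let f : N →ₐ[ℚ] L := IsAlgClosed.lift
  have eN : N ≃ₐ[ℚ] f.fieldRange := f.equivFieldRange
  let N₀ : IntermediateField ℚ L := f.fieldRange
  haveI : FiniteDimensional ℚ N₀ := eN.toLinearEquiv.finiteDimensional
  haveI : Normal ℚ N₀ := Normal.of_algEquiv eN
  obtain ⟨q, hq⟩ : ∃ q : Field.absoluteGaloisGroup ℚ →* (N₀ ≃ₐ[ℚ] N₀),
      q = AlgEquiv.restrictNormalHom N₀ := ⟨_, rfl⟩
  have hqA : IsArtinQuotient q := isArtinQuotient_of_eq_restrictNormalHom hq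
  haveI hNF : ∀ H', NumberField (quotientFixedField q H') :=
    fun H' => numberField_quotientFixedField hqA H'
  have hE : E.map f ≤ N₀ := IntermediateField.map_le_iff_le_comap.mpr fun x _ => ⟨x, rfl⟩
  set H : Subgroup (N₀ ≃ₐ[ℚ] N₀) := ((E.map f).fixingSubgroup).map q with hHdef
  have hHE : quotientFixedField q H = E.map f := quotientFixedField_map_fixingSubgroup hq hE
  have hbot : quotientFixedField q ⊥ = N₀ := quotientFixedField_bot_of_eq_restrictNormalHom hq
  have e1 : quotientFixedField q H ≃+* E :=
    ((IntermediateField.equivOfEq hHE).trans (E.equivMap f).symm).toRingEquiv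
  have e0 : quotientFixedField q (⊥ : Subgroup (N₀ ≃ₐ[ℚ] N₀)) ≃+* N :=
    ((IntermediateField.equivOfEq hbot).trans eN.symm).toRingEquiv
  have hH0 : dedekindZetaCont (quotientFixedField q H) s₀ = 0 := by
    rw [dedekindZetaCont_eq_of_ringEquiv e1 hs₀]; exact h0
  have h := Heilbronn.dedekindZetaCont_quotientFixedField_bot_eq_zero hqA hs₀ H hH0
  rwa [dedekindZetaCont_eq_of_ringEquiv e0 hs₀] at h

/-- The same for the fixed field of a subgroup `H ≤ Gal(N/ℚ)`: `ζ_{N^H}(s₀) = 0 ⟹ ζ_N(s₀) = 0`.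
[cite: MurtyMurty1997, Ch. 2 §5 Prop. 5.2] -/
theorem dedekindZetaCont_eq_zero_of_fixedField (H : Subgroup (N ≃ₐ[ℚ] N)) {s₀ : ℂ}
    (hs₀ : s₀ ≠ 1) (h0 : dedekindZetaCont (IntermediateField.fixedField H) s₀ = 0) :
    dedekindZetaCont N s₀ = 0 :=
  dedekindZetaCont_eq_zero_of_intermediateField N (IntermediateField.fixedField H) hs₀ h0

/-- **Stark's theorem for the subfields of a Galois number field.**  Let `N/ℚ` be Galois of degree
`> 1` and `σ` real with `1 − 1/(4 log|d_N|) ≤ σ < 1` and `ζ_N(σ) = 0`.  Then there is a quadratic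
subfield `k ⊆ N` such that for every intermediate field `E ⊆ N`: `ζ_E(σ) = 0 ↔ k ⊆ E`.
(`ord_σ ζ_N ≤ 1` by Stark's Lemma 3; Heilbronn's character is then a quadratic character `χ₁` of
`Gal(N/ℚ)` and `ζ_{N^H}(σ) = 0 ↔ H ≤ ker χ₁`; `k = N^{ker χ₁}`.)
[cite: Stark1974, Thm. 3 and Lemma 3] [cite: MurtyMurty1997, Ch. 2 Prop. 5.2, Cor. 6.2] -/
theorem exists_quadratic_forall_dedekindZetaCont_eq_zero_iff (hN : 1 < Module.finrank ℚ N) {σ : ℝ}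
    (hσ : 1 - 1 / (4 * Real.log ((discr N).natAbs : ℝ)) ≤ σ) (hσ1 : σ < 1)
    (h0 : dedekindZetaCont N σ = 0) :
    ∃ k : IntermediateField ℚ N, Module.finrank ℚ k = 2 ∧
      ∀ E : IntermediateField ℚ N, dedekindZetaCont E σ = 0 ↔ k ≤ E := by
  classical
  -- `|d_N| ≥ 3`, `0 < σ < 1`
  have hdN : 3 ≤ (discr N).natAbs := three_le_natAbs_discr N hN
  have hσ0 : 0 < σ := by
    have hd3 : (3 : ℝ) ≤ ((discr N).natAbs : ℝ) := by exact_mod_cast hdN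
    have hlog : 1 < Real.log ((discr N).natAbs : ℝ) := by
      have h3 : 1 < Real.log 3 := by
        have := Real.log_two_gt_d9
        have h23 : Real.log 2 * (3 / 2) ≤ Real.log 3 := by
          have := Real.log_le_log (by norm_num : (0:ℝ) < 2 ^ (3:ℕ)) (by norm_num : (2:ℝ) ^ (3:ℕ) ≤ 3 ^ (2:ℕ))
          rw [Real.log_pow, Real.log_pow] at this
          push_cast at this
          linarith
        linarith
      exact lt_of_lt_of_le h3 (Real.log_le_log (by norm_num) hd3)
    have : 1 / (4 * Real.log ((discr N).natAbs : ℝ)) ≤ 1 / 4 := by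
      rw [div_le_div_iff_of_pos_left one_pos (by positivity) (by norm_num)]
      linarith
    linarith
  have hs1 : (σ : ℂ) ≠ 1 := fun h => hσ1.ne (by exact_mod_cast h)
  have hreal : conj (σ : ℂ) = σ := Complex.conj_ofReal σ
  -- embed `N` in `ℚ̄`: `N₀ = f(N)` normal, `q : Γ_ℚ → Gal(N₀/ℚ)`
  let L := AlgebraicClosure ℚ
  let f : N →ₐ[ℚ] L := IsAlgClosed.lift
  have eN : N ≃ₐ[ℚ] f.fieldRange := f.equivFieldRange
  let N₀ : IntermediateField ℚ L := f.fieldRange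
  haveI : FiniteDimensional ℚ N₀ := eN.toLinearEquiv.finiteDimensional
  haveI : Normal ℚ N₀ := Normal.of_algEquiv eN
  obtain ⟨q, hq⟩ : ∃ q : Field.absoluteGaloisGroup ℚ →* (N₀ ≃ₐ[ℚ] N₀),
      q = AlgEquiv.restrictNormalHom N₀ := ⟨_, rfl⟩
  have hqA : IsArtinQuotient q := isArtinQuotient_of_eq_restrictNormalHom hq
  haveI hNF : ∀ H', NumberField (quotientFixedField q H') :=
    fun H' => numberField_quotientFixedField hqA H'
  have hbot : quotientFixedField q ⊥ = N₀ := quotientFixedField_bot_of_eq_restrictNormalHom hq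
  have htop' : quotientFixedField q ⊤ = ⊥ := quotientFixedField_top_eq_bot (q := q)
  haveI : NumberField N₀ := NumberField.of_module_finite ℚ N₀
  -- `σ` lies in Stark's box for `N₀` (`d_{N₀} = d_N`), so `ord_σ ζ_{N₀} ≤ 1`
  have hdisc : discr N₀ = discr N := (NumberField.discr_eq_discr_of_algEquiv N eN).symm
  have hN1 : 1 < @Module.finrank ℚ N₀ _ _ DivisionRing.toRatAlgebra.toModule := by
    rw [← finrank_rat_eq_finrank_rat _ (IntermediateField.module' N₀), ← eN.toLinearEquiv.finrank_eq]
    exact hN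
  have hbox : (σ : ℂ) ∈ starkBox ((discr N₀).natAbs : ℝ) := by
    rw [hdisc]
    exact ofReal_mem_starkBox (by exact_mod_cast (show 1 ≤ (discr N).natAbs by omega)) hσ
  have e3 : quotientFixedField q (⊥ : Subgroup (N₀ ≃ₐ[ℚ] N₀)) ≃+* N₀ :=
    (IntermediateField.equivOfEq hbot).toRingEquiv
  have hle :
      artinOrder (σ : ℂ) ((Representation.leftRegular ℂ (N₀ ≃ₐ[ℚ] N₀)).character ∘ q) ≤ 1 := by
    have h1 := artinOrder_leftRegular hqA (σ : ℂ)
    rw [meromorphicOrderAt_dedekindZetaCont_eq_of_ringEquiv e3 hs1] at h1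
    have h3 := meromorphicOrderAt_dedekindZetaCont_le_one N₀ hN1 hs1 hbox
    rw [← h1] at h3
    exact_mod_cast h3
  -- `ζ_ℚ(σ) = ζ(σ) < 0`
  have e2 : quotientFixedField q (⊤ : Subgroup (N₀ ≃ₐ[ℚ] N₀)) ≃+* ℚ :=
    ((IntermediateField.equivOfEq htop').trans (IntermediateField.botEquiv ℚ L)).toRingEquiv
  have htop : dedekindZetaCont (quotientFixedField q (⊤ : Subgroup (N₀ ≃ₐ[ℚ] N₀))) σ ≠ 0 := by
    rw [dedekindZetaCont_eq_of_ringEquiv e2 hs1, dedekindZetaCont_rat_eq_riemannZeta_holds hs1]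
    exact (riemannZeta_neg_of_pos_of_lt_one hσ0 hσ1).ne
  -- `ζ_{F_⊥}(σ) = ζ_N(σ) = 0`
  have e0 : quotientFixedField q (⊥ : Subgroup (N₀ ≃ₐ[ℚ] N₀)) ≃+* N := (e3.trans eN.symm.toRingEquiv)
  have hbot0 : dedekindZetaCont (quotientFixedField q (⊥ : Subgroup (N₀ ≃ₐ[ℚ] N₀))) σ = 0 := by
    rw [dedekindZetaCont_eq_of_ringEquiv e0 hs1]; exact h0
  -- the dictionary `E ↦ H_E = q(Γ_{f(E)})`, `F_{H_E} = f(E)`, `ζ_{F_{H_E}} = ζ_E`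
  have hEN : ∀ E : IntermediateField ℚ N, E.map f ≤ N₀ := fun E =>
    IntermediateField.map_le_iff_le_comap.mpr fun x _ => ⟨x, rfl⟩
  have hHE : ∀ E : IntermediateField ℚ N,
      quotientFixedField q (((E.map f).fixingSubgroup).map q) = E.map f := fun E =>
    quotientFixedField_map_fixingSubgroup hq (hEN E)
  have hzeta : ∀ E : IntermediateField ℚ N,
      dedekindZetaCont (quotientFixedField q (((E.map f).fixingSubgroup).map q)) σ =
        dedekindZetaCont E σ := by
    intro E
    have e1 : quotientFixedField q (((E.map f).fixingSubgroup).map q) ≃+* E :=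
      ((IntermediateField.equivOfEq (hHE E)).trans (E.equivMap f).symm).toRingEquiv
    exact dedekindZetaCont_eq_of_ringEquiv e1 hs1
  -- Heilbronn's character is a quadratic character `χ₁ ≠ 1`
  rcases heilbronnChar_eq_zero_or_eq_coe hqA hs1 hreal hle with hθ | ⟨χ₁, hθ, hpm⟩
  · exact absurd hbot0 (dedekindZetaCont_quotientFixedField_ne_zero_of_eq_zero hqA hs1 hθ ⊥)
  have hne : χ₁ ≠ 1 := by
    intro h1
    apply htop
    rw [dedekindZetaCont_quotientFixedField_eq_zero_iff hqA hs1 hθ ⊤, h1, MonoidHom.ker_one]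
  have hidx : χ₁.ker.index = 2 := index_ker_eq_two_of_sign hpm hne
  -- the quadratic field `k₁ = F_{ker χ₁} ⊆ N₀` and its preimage `k ⊆ N`
  set k₁ : IntermediateField ℚ L := quotientFixedField q χ₁.ker with hk₁def
  have hk₁N : k₁ ≤ N₀ := hbot ▸ quotientFixedField_antitone (q := q) bot_le
  have h2' : Module.finrank ℚ k₁ = 2 := (finrank_quotientFixedField hqA χ₁.ker).trans hidx
  set k : IntermediateField ℚ N := k₁.comap f with hkdef
  have hmap : k.map f = k₁ := by
    apply le_antisymm ((IntermediateField.gc_map_comap f).l_u_le k₁)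
    intro x hx
    obtain ⟨y, rfl⟩ := hk₁N hx
    exact ⟨y, hx, rfl⟩
  have e4 : k ≃ₐ[ℚ] k₁ := (k.equivMap f).trans (IntermediateField.equivOfEq hmap)
  refine ⟨k, ?_, fun E => ?_⟩
  · have h := e4.toLinearEquiv.finrank_eq
    rw [h]
    convert h2' using 2
  -- `ζ_E(σ) = 0 ↔ H_E ≤ ker χ₁ ↔ k₁ ≤ f(E) ↔ k ≤ E`
  rw [← hzeta E, dedekindZetaCont_quotientFixedField_eq_zero_iff hqA hs1 hθ,
    ← le_map_iff_comap_le_of_le_fieldRange f hk₁N E]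
  constructor
  · -- `H_E ≤ ker χ₁ ⟹ F_{ker χ₁} ≤ F_{H_E} = f(E)`
    intro h
    rw [← hHE E]
    exact quotientFixedField_antitone (q := q) h
  · -- `k₁ ≤ f(E) ⟹ Γ_{f(E)} ≤ Γ_{k₁} = q⁻¹(ker χ₁) ⟹ H_E ≤ ker χ₁`
    intro h
    have h1 : (E.map f).fixingSubgroup ≤ k₁.fixingSubgroup := IntermediateField.fixingSubgroup_le h
    have hclosed : IsClosed ((χ₁.ker.comap q : Subgroup (L ≃ₐ[ℚ] L)) : Set (L ≃ₐ[ℚ] L)) :=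
      Subgroup.isClosed_of_isOpen _ (hqA.isOpen_comap χ₁.ker)
    have h2 : k₁.fixingSubgroup = χ₁.ker.comap q := by
      have := InfiniteGalois.fixingSubgroup_fixedField ⟨χ₁.ker.comap q, hclosed⟩
      exact this
    have h3 : ((E.map f).fixingSubgroup).map q ≤ (χ₁.ker.comap q).map q :=
      Subgroup.map_mono (h1.trans_eq h2)
    rwa [Subgroup.map_comap_eq_self_of_surjective hqA.surjective] at h3

/-- **Stark's theorem for the subfields of a Galois field, subgroup form**: under the hypotheses of
`exists_quadratic_forall_dedekindZetaCont_eq_zero_iff` there is a subgroup `K₁ ≤ Gal(N/ℚ)` of index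
`2` such that for every subgroup `H`: `ζ_{N^H}(σ) = 0 ↔ H ≤ K₁`.
[cite: Stark1974, Thm. 3] [cite: MurtyMurty1997, Ch. 2 Prop. 5.2] -/
theorem exists_index_two_forall_dedekindZetaCont_fixedField_eq_zero_iff
    (hN : 1 < Module.finrank ℚ N) {σ : ℝ}
    (hσ : 1 - 1 / (4 * Real.log ((discr N).natAbs : ℝ)) ≤ σ) (hσ1 : σ < 1)
    (h0 : dedekindZetaCont N σ = 0) :
    ∃ K₁ : Subgroup (N ≃ₐ[ℚ] N), K₁.index = 2 ∧
      ∀ H : Subgroup (N ≃ₐ[ℚ] N),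
        dedekindZetaCont (IntermediateField.fixedField H) σ = 0 ↔ H ≤ K₁ := by
  classical
  obtain ⟨k, hk2, hk⟩ := exists_quadratic_forall_dedekindZetaCont_eq_zero_iff N hN hσ hσ1 h0
  refine ⟨k.fixingSubgroup, ?_, fun H => ?_⟩
  · -- `[G : Gal(N/k)] = [k : ℚ] = 2`
    have h1 : k.fixingSubgroup.index * Nat.card k.fixingSubgroup = Nat.card (N ≃ₐ[ℚ] N) :=
      Subgroup.index_mul_card _
    have h2 : Nat.card k.fixingSubgroup = Module.finrank k N := by
      rw [← IntermediateField.finrank_fixedField_eq_card, IsGalois.fixedField_fixingSubgroup]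
    have h3 : Nat.card (N ≃ₐ[ℚ] N) = Module.finrank ℚ N := IsGalois.card_aut_eq_finrank ℚ N
    have h4 : Module.finrank ℚ k * Module.finrank k N = Module.finrank ℚ N := Module.finrank_mul_finrank ℚ k N
    have hpos : 0 < Module.finrank k N := Module.finrank_pos
    rw [h2, h3, ← h4, hk2] at h1
    exact Nat.eq_of_mul_eq_mul_right hpos h1
  · rw [hk, IntermediateField.le_iff_le]

end Galois

end NumberField

end Literature.NumberTheory.LFunctions

end
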